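import Summits.ResolutionOfSingularities.ResolutionOfSingularities.Theorems.EquisingularLiftEquisingularLiftNatChartLiftTorsor
import HarnessLib

/-!
# [OURS · L1 W4.5(b) · EL♮(3) · J1c (π) brick F5, part 2] The chart torsor: action of the sections, restriction to smaller charts

Sequel of `…NatChartLiftTorsor` (brick F5 of the (π) patching engine, res-type-027 g17; crux chain w45b, child crux **EL♮(3)** =
stmt-ResolutionOfSingularities-20148; J1 = `EmbeddedInfinitesimalLiftFact`, p596985). Same ABSTRACT CHART CURRENCY (base `C'`, `ε ∈ 𝔪`, `ann ε = 𝔪`;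
chart ring `A'` with `π : A' ↠ Γ(W₀, V)`, `ker π = 𝔪A'`; lifts `J` with `A'/J` flat and `π(J) = 𝓘(V)`; `IsDiffSec` the difference-section predicate):
* `exists_lift_isDiffSec` — **action / transitivity** (Hartshorne 2010, proof of Thm. 6.2 (a): «given `I'` and `φ` … we define another ideal `I''`»):
  every section `μ ∈ Γ(ι⁻¹V, 𝒩)` is the difference section of `J` and some lift `J''` with flat quotient, `J'' + (ε) = J + (ε)`, `π(J'') = 𝓘(V)`
  (`J'' = act ε J φ_μ`, J1b-β p600361, where `φ_μ` reads `μ` through `A'/(J + 𝔪A') ≅ Γ(ι⁻¹V, 𝒪_{Y₀})`);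
* `map_map_eq_ker_ideal`, `isDiffSec_restrict` — **restriction**: along a `C'`-algebra map of charts `f : A' → A₁` over `V₁ ⊆ V` (`π₁ ∘ f = res ∘ π`),
  the difference section of the extended lifts `J·A₁, J'·A₁` is the restriction of the difference section of `J, J'` (uniqueness on the smaller chart
  + F4 naturality).
OURS; NOT a statement of H. Hironaka's 2017 manuscript; AI-written, gate-checked, weaker than expert review. DEF-FREE; no `sorry`; standard axioms.
`--supports stmt-ResolutionOfSingularities-20148 --as helper`.

References (method / index only): R. Hartshorne, *Deformation Theory* (2010), Thm. 6.2 (a) and its proof pp. 47–48.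
-/

set_option linter.dupNamespace false -- mandated namespace `Summit.<Summit>.<Problem>` of this single-conjunct summit

noncomputable section

open CategoryTheory CategoryTheory.Limits AlgebraicGeometry Opposite TopologicalSpace
open Literature.AlgebraicGeometry.Modules Literature.AlgebraicGeometry.Deformation Literature.AlgebraicGeometry.HodgeTheory

namespace Summit.ResolutionOfSingularities.ResolutionOfSingularities.Cruxes.EquisingularLiftNat.Sections

variable {C' : Type} [CommRing C'] {𝔪 : Ideal C'} {ε : C'}
variable {W₀ Y₀ : Scheme.{0}} (ι : Y₀ ⟶ W₀)
variable {A' : Type} [CommRing A'] [Algebra C' A']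

/-! ## The action: every section is a difference section -/

section Action

variable [IsClosedImmersion ι] [IsLocallyNoetherian W₀]
variable (hann : ∀ c : C', ε * c = 0 ↔ c ∈ 𝔪) (hεm : ε ∈ 𝔪)
variable {V : W₀.affineOpens} (π : A' →+* Γ(W₀, (V : W₀.Opens))) (hπ : Function.Surjective π) (hkerπ : RingHom.ker π = 𝔪.map (algebraMap C' A'))

omit [IsLocallyNoetherian W₀] in
include hann hεm hπ hkerπ in
/-- **Action / transitivity of the chart torsor** (Hartshorne 2010, proof of Thm. 6.2 (a): «given `I'` and `φ` … we define another ideal `I''`»):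
for a lift `J` (`A'/J` flat, `π(J) = 𝓘(V)`) and ANY section `μ` of `𝒩` over `ι⁻¹V` there is a lift `J''` — flat quotient, same reduction modulo `ε`,
`π(J'') = 𝓘(V)` — whose difference section with `J` is `μ` (namely `act ε J φ_μ`, J1b-β p600361, `φ_μ` = `μ` read through `A'/(J + 𝔪A') ≅ Γ(ι⁻¹V, 𝒪)`).
[cite: Hartshorne2010, Thm. 6.2 (a) (proof, affine case)] -/
theorem exists_lift_isDiffSec (J : Ideal A') [Module.Flat C' (A' ⧸ J)] (hJ : J.map π = ι.ker.ideal V)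
    (μ : (conormalSheaf ι).over (ι ⁻¹ᵁ (V : W₀.Opens)) ⟶ (unitModule Y₀).over (ι ⁻¹ᵁ (V : W₀.Opens))) :
    ∃ J'' : Ideal A', Module.Flat C' (A' ⧸ J'') ∧ J'' ⊔ Ideal.span {algebraMap C' A' ε} = J ⊔ Ideal.span {algebraMap C' A' ε} ∧
      J''.map π = ι.ker.ideal V ∧ IsDiffSec ι ε π J J'' μ := by
  classical
  -- the residue ring `A'/(J + 𝔪A') ≅ Γ(ι⁻¹V, 𝒪_{Y₀})`
  set ρ : A' →+* Γ(Y₀, ι ⁻¹ᵁ (V : W₀.Opens)) := (ι.app (V : W₀.Opens)).hom.comp π with hρ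
  have hρsurj : Function.Surjective ρ := app_comp_surjective ι π hπ
  have hρker : RingHom.ker ρ = J ⊔ 𝔪.map (algebraMap C' A') := ker_app_comp_eq_sup ι π hπ hkerπ hJ
  let Φ : A' ⧸ (J ⊔ 𝔪.map (algebraMap C' A')) ≃+* Γ(Y₀, ι ⁻¹ᵁ (V : W₀.Opens)) :=
    (Ideal.quotEquivOfEq hρker.symm).trans (RingHom.quotientKerEquivOfSurjective hρsurj)
  have hΦ : ∀ a : A', Φ (Ideal.Quotient.mk _ a) = ρ a := fun a => by
    simp only [Φ, RingEquiv.trans_apply, Ideal.quotEquivOfEq_mk, RingHom.quotientKerEquivOfSurjective_apply_mk]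
  -- sections of `𝓘` reading the elements of `π(J) = 𝓘(V)`
  have hsec : ∀ j : J, ∃ m : Γ(idealModule ι, (V : W₀.Opens)), toRing (idealModuleι ι) (V : W₀.Opens) m = π j :=
    fun j => exists_toRing_eq_apply ι π hJ.le j.2
  choose sec hsec using hsec
  have hsec_add : ∀ j j' : J, sec (j + j') = sec j + sec j' := fun j j' =>
    idealModule_section_eq_of_toRing_eq ι (V : W₀.Opens) (by rw [toRing_add, hsec, hsec, hsec, Submodule.coe_add, map_add])
  have hsec_smul : ∀ (a : A') (j : J), sec (a • j) = π a • sec j := fun a j =>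
    idealModule_section_eq_of_toRing_eq ι (V : W₀.Opens) (by rw [toRing_smul, hsec, hsec, Submodule.coe_smul, smul_eq_mul, map_mul])
  -- the class `φ_μ : J → A'/(J + 𝔪A')`
  let val : J → Γ(Y₀, ι ⁻¹ᵁ (V : W₀.Opens)) := fun j => appLE μ (𝟙 _) (unitSectionLE ι (idealModule ι) (le_refl _) (sec j))
  have hval_add : ∀ j j' : J, val (j + j') = val j + val j' := fun j j' => by
    simp only [val, hsec_add, unitSectionLE_add]
    exact appLE_add_right μ _ _ _
  have hval_smul : ∀ (a : A') (j : J), val (a • j) = ρ a * val j := fun a j => by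
    simp only [val, hsec_smul, unitSectionLE_smul, Scheme.Hom.appLE_eq_app]
    exact appLE_smul_right μ (𝟙 _) _ _
  let φ : J →ₗ[A'] A' ⧸ (J ⊔ 𝔪.map (algebraMap C' A')) :=
    { toFun := fun j => Φ.symm (val j)
      map_add' := fun j j' => by rw [hval_add, map_add]
      map_smul' := fun a j => by
        rw [hval_smul, RingHom.id_apply, ← hΦ a, show Φ (Ideal.Quotient.mk _ a) * val j = Φ (Ideal.Quotient.mk _ a * Φ.symm (val j)) by
          rw [map_mul, RingEquiv.apply_symm_apply], RingEquiv.symm_apply_apply, Algebra.smul_def, Ideal.Quotient.algebraMap_eq] }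
  have hφ : ∀ j : J, Φ (φ j) = val j := fun j => RingEquiv.apply_symm_apply Φ (val j)
  -- Hartshorne's second lift
  haveI hflat : Module.Flat C' (A' ⧸ act ε J φ) := flat_quotient_act ε J φ hann hεm
  refine ⟨act ε J φ, hflat, act_sup_span_eq ε J φ, ?_, ?_⟩
  · apply le_antisymm
    · rw [← hJ]; exact map_le_map_of_le_sup_span π hεm hkerπ (act_le_sup ε J φ)
    · rw [← hJ]; exact map_le_map_of_le_sup_span π hεm hkerπ (le_act_sup ε J φ)
  · intro m j y hj hm hy
    obtain ⟨t, ht⟩ := Ideal.Quotient.mk_surjective (φ ⟨j, hj⟩)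
    have h1 := liftDiff_act hann hεm J φ ⟨j, hj⟩ t ht
    have h2 := liftDiff_apply_of_sub_mem hann J (act ε J φ) (le_act_sup ε J φ) ⟨j, hj⟩ y hy
    have hty : t - y ∈ J ⊔ 𝔪.map (algebraMap C' A') := by
      rw [← act_sup_map_eq ε J φ hεm, ← Ideal.Quotient.eq]
      exact h1.symm.trans h2
    have hρty : ρ t = ρ y := by
      have h0 : ρ (t - y) = 0 := by rw [← RingHom.mem_ker, hρker]; exact hty
      rwa [map_sub, sub_eq_zero] at h0
    -- `μ(η m) = Φ(φ j) = ρ t = ρ y`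
    have hmsec : m = sec ⟨j, hj⟩ := idealModule_section_eq_of_toRing_eq ι (V : W₀.Opens) (by rw [hsec, hm])
    have hv : appLE μ (𝟙 _) (unitSectionLE ι (idealModule ι) (le_refl _) m) = val ⟨j, hj⟩ := by rw [hmsec]
    rw [hv, ← hφ, ← ht, hΦ, hρty]
    rfl

end Action

/-! ## Restriction to a smaller chart -/

section Restrict

variable [IsClosedImmersion ι] [IsLocallyNoetherian W₀]
variable (hann : ∀ c : C', ε * c = 0 ↔ c ∈ 𝔪) (hεm : ε ∈ 𝔪)
variable {V V₁ : W₀.affineOpens} (k : (V₁ : W₀.Opens) ≤ V) {n : ℕ} (x : Fin n → Γ(W₀, (V : W₀.Opens)))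
  (hreg : RingTheory.Sequence.IsWeaklyRegular Γ(W₀, (V : W₀.Opens)) (List.ofFn x)) (hI₀ : Ideal.span (Set.range x) = ι.ker.ideal V)
  (π : A' →+* Γ(W₀, (V : W₀.Opens))) (hπ : Function.Surjective π) (hkerπ : RingHom.ker π = 𝔪.map (algebraMap C' A'))
  {A₁ : Type} [CommRing A₁] [Algebra C' A₁] (f : A' →ₐ[C'] A₁)
  (π₁ : A₁ →+* Γ(W₀, (V₁ : W₀.Opens))) (hπ₁ : Function.Surjective π₁) (hkerπ₁ : RingHom.ker π₁ = 𝔪.map (algebraMap C' A₁))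
  (hcomm : ∀ a : A', π₁ (f a) = W₀.presheaf.map (homOfLE k).op (π a))

omit [IsClosedImmersion ι] [IsLocallyNoetherian W₀] in
include hcomm in
/-- The extended lift on the smaller chart still reads the ideal: `π₁(J·A₁) = 𝓘(V₁)`. [folklore] -/
theorem map_map_eq_ker_ideal (J : Ideal A') (hJ : J.map π = ι.ker.ideal V) : (J.map f).map π₁ = ι.ker.ideal V₁ := by
  have h : (π₁.comp f.toRingHom) = (W₀.presheaf.map (homOfLE k).op).hom.comp π := RingHom.ext fun a => hcomm a
  change (J.map f.toRingHom).map π₁ = _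
  rw [Ideal.map_map, h, ← Ideal.map_map, hJ]
  exact ι.ker.map_ideal (show V₁ ≤ V from k)

include hann hreg hI₀ hπ hπ₁ hkerπ₁ hcomm in
/-- **The difference section restricts**: for a `C'`-algebra map `f : A' → A₁` of charts over `V₁ ⊆ V` (`π₁ ∘ f = res ∘ π`), the difference section of
the extended lifts `J·A₁, J'·A₁` on `V₁` is the restriction of the difference section of `J, J'` (Hartshorne 2010, §6: the construction «is compatible
with localization»; here: uniqueness on the smaller chart, F4 naturality, `liftDiff_map` in representative form). [cite: Hartshorne2010, Thm. 6.2 (a)] -/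
theorem isDiffSec_restrict (J J' : Ideal A') [Module.Flat C' (A' ⧸ J)] [Module.Flat C' (A' ⧸ J')] [Module.Flat C' (A₁ ⧸ J.map f)]
    [Module.Flat C' (A₁ ⧸ J'.map f)] (hJ : J.map π = ι.ker.ideal V) (hJ' : J'.map π = ι.ker.ideal V)
    (hI : J ≤ J' ⊔ Ideal.span {algebraMap C' A' ε})
    {μ : (conormalSheaf ι).over (ι ⁻¹ᵁ (V : W₀.Opens)) ⟶ (unitModule Y₀).over (ι ⁻¹ᵁ (V : W₀.Opens))} (hμ : IsDiffSec ι ε π J J' μ) :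
    IsDiffSec ι ε π₁ (J.map f) (J'.map f) (restrictHom (homOfLE (ι.preimage_mono k)) μ) := by
  obtain ⟨hreg₁, hI₁⟩ := isWeaklyRegular_and_span_eq_of_le ι k x hreg hI₀
  have hJ₁ := map_map_eq_ker_ideal ι k π f π₁ hcomm J hJ
  have hJ'₁ := map_map_eq_ker_ideal ι k π f π₁ hcomm J' hJ'
  have hIf : J.map f ≤ J'.map f ⊔ Ideal.span {algebraMap C' A₁ ε} := map_le_map_sup_span f J J' hI
  obtain ⟨μ₁, hμ₁⟩ := exists_isDiffSec ι hann _ hreg₁ hI₁ π₁ hπ₁ hkerπ₁ (J.map f) (J'.map f) hJ₁ hJ'₁ hIf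
  suffices h : restrictHom (homOfLE (ι.preimage_mono k)) μ = μ₁ by rw [h]; exact hμ₁
  refine normalSection_ext_of_le ι k x hreg hI₀ fun m => ?_
  obtain ⟨j, hj, hjm⟩ := exists_mem_apply_eq_toRing ι π hπ hJ m
  obtain ⟨y, hy⟩ := exists_sub_mul_mem J J' hI ⟨j, hj⟩
  rw [appLE_restrictHom_unitSectionLE_map, hμ m j y hj hjm.symm hy]
  have hfj : f j ∈ J.map f := Ideal.mem_map_of_mem f hj
  have hread : toRing (idealModuleι ι) (V₁ : W₀.Opens) ((idealModule ι).presheaf.map (homOfLE k).op m) = π₁ (f j) := by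
    rw [← map_toRing, hjm.symm, hcomm]
  have hfy : f j - algebraMap C' A₁ ε * f y ∈ J'.map f := by
    have := Ideal.mem_map_of_mem f hy
    rwa [map_sub, map_mul, AlgHom.commutes] at this
  rw [hμ₁ _ (f j) (f y) hfj hread hfy, hcomm]
  -- naturality of `ι♯`
  change (ι.app (V : W₀.Opens) ≫ Y₀.presheaf.map (homOfLE (ι.preimage_mono k)).op).hom (π y) =
    (W₀.presheaf.map (homOfLE k).op ≫ ι.app (V₁ : W₀.Opens)).hom (π y)
  rw [ι.naturality (homOfLE k).op]
  rfl

end Restrict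

end Summit.ResolutionOfSingularities.ResolutionOfSingularities.Cruxes.EquisingularLiftNat.Sections

end
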